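import Literature.NumberTheory.Sieve.TypeTwoBlock
import Literature.NumberTheory.Sieve.BalancedGenerators
import Literature.NumberTheory.LFunctions.PrimesInRayClasses
import HarnessLib

/-!
# The type II mean value bound (Hinz 1988, §4 (4.20), smooth form)

Topic `Literature/NumberTheory/Sieve`, sub-namespace `TypeTwoBound`. This file assembles Hinz's
estimate (4.20) for the type II sums
`S₄(χ) = ∑_{N𝔟 > U} Λ(𝔟) ∑_{α ∈ A₀(M), 𝔟 ∣ (α) ≠ 𝔟} Ω(α) χ(α) e_U((α)/𝔟)`
averaged over the primitive characters of the moduli `Q₁ < N𝔮 ≤ Q`: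

* auxiliary primes `𝔭₂ ∈ ℭ`, `𝔭₁ ∈ ℭ⁻¹` of norm `> 2Q` in every narrow class (Landau; tree
  `infinite_setOf_rayClassRel_and_prime_absNorm`) and balanced totally positive generators
  (`Balanced.exists_balanced_totPos`) — `exists_prime_nclass_eq`, `exists_classData`;
* the blocks `N𝔟 > M^d/U` vanish (`e_U(𝔠) = [𝔠 = 1]` for `N𝔠 ≤ U`) — `S4block_filter_large`;
* decomposition of the `𝔟`-range into narrow classes and dyadic ranges, `TypeTwoBlock.block_bound`
  for each block and each dyadic range of moduli (`1/φ(𝔮) ≤ (2/P)·N𝔮/φ(𝔮)` for `N𝔮 ≥ P/2`),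
  and the summations `∑ P ≤ 4Q`, `∑ 1 ≪ log Q`, `∑ 1/P ≤ 2/Q₁`.

Main result `typeII_bound`:
`∑_{Q₁<N𝔮≤Q} (1/φ(𝔮)) ∑*_χ |S₄(χ)| ≤ C ‖k̂‖₁^d (log M)^{d+2} √(H(U)³) (Q M^{d/2} + M^d/√U + M^d/Q₁)`
for `3 ≤ M`, `1 ≤ U`, `1 ≤ Q₁ ≤ Q ≤ M^d` — Hinz's (4.20) with the smooth weight.

## References

* J. Hinz, Acta Arith. 51 (1988), §4, (4.10)–(4.20). [cite: Hinz1988, §4 (4.20)]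
* E. Landau, Über Ideale und Primideale in Idealklassen, Math. Z. 2 (1918), §1.
  [cite: Landau1918Idealklassen, §1 Satz]
-/

noncomputable section

open Finset NumberField NumberField.InfinitePlace MeasureTheory IsDedekindDomain
  Literature.NumberTheory.Sieve.NumberFieldLS Literature.NumberTheory.Sieve.BoxPrimes
  Literature.NumberTheory.Sieve.NumberFieldVaughan Literature.NumberTheory.Sieve.LogSep
  Literature.NumberTheory.Sieve.MitsuiPNT Literature.NumberTheory.LFunctions
  Literature.NumberTheory.LFunctions.NumberField Literature.NumberTheory.Sieve.CastilloEtAl2015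
  Literature.NumberTheory.Sieve.TypeTwoReparam Literature.NumberTheory.Sieve.TypeTwoCoeff
  Literature.NumberTheory.Sieve.TypeTwoBlock Literature.NumberTheory.Sieve.PrimRed
  Literature.NumberTheory.LFunctions.HeckeCone Literature.NumberTheory.Sieve.Balanced
open scoped Classical FourierTransform

namespace Literature.NumberTheory.Sieve.TypeTwoBound

variable {K : Type*} [Field K] [NumberField K] [IsTotallyReal K]

local notation "d" => Module.finrank ℚ K
local notation "RP" => {w : InfinitePlace K // IsReal w}
local notation "rk" => Module.finrank ℝ (NumberField.Units.dirichletUnitTheorem.logSpace K)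

/-! ## Primes of large norm in a narrow class -/

omit [IsTotallyReal K] in
/-- **Every narrow class contains primes of arbitrarily large norm** (Landau 1918).
[cite: Landau1918Idealklassen, §1 Satz] -/
theorem exists_prime_nclass_eq {I : Ideal (𝓞 K)} (hI : I ≠ ⊥) (Q : ℝ) :
    ∃ v : HeightOneSpectrum (𝓞 K), nclass v.asIdeal = nclass I ∧ Q < (Ideal.absNorm v.asIdeal : ℝ) := by
  have hinf := infinite_setOf_rayClassRel_and_prime_absNorm (K := K) top_ne_bot_ideal ⟨I, hI, isCoprime_top I⟩
  have hfin : {v : HeightOneSpectrum (𝓞 K) | (Ideal.absNorm v.asIdeal : ℝ) ≤ Q}.Finite := by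
    refine Set.Finite.of_finite_image (f := fun v => v.asIdeal) ?_ (fun v _ w _ h => HeightOneSpectrum.ext h)
    refine (idealsLE K Q).finite_toSet.subset ?_
    rintro _ ⟨v, hv, rfl⟩
    rw [Finset.mem_coe, mem_idealsLE]
    exact ⟨v.ne_bot, hv⟩
  obtain ⟨v, ⟨⟨hv, hrel⟩, -⟩, hvQ⟩ := (hinf.sdiff hfin).nonempty
  refine ⟨v, ?_, lt_of_not_ge hvQ⟩
  have hmem : v ∈ {v : HeightOneSpectrum (𝓞 K) | ¬ (⊤ : Ideal (𝓞 K)) ≤ v.asIdeal ∧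
      RayClassRel ⊤ (⟨I, hI, isCoprime_top I⟩ : CoprimeIdeal (⊤ : Ideal (𝓞 K))).1 v.asIdeal} := ⟨hv, hrel⟩
  rw [setOf_rayClassRel_eq_frobFiber top_ne_bot_ideal, mem_frobFiber_primeRayClass] at hmem
  rw [nclass_asIdeal, hmem.2, nclass_of_ne_bot hI]

omit [NumberField K] [IsTotallyReal K] in
/-- Positive rational integers are totally positive. [folklore] -/
theorem isTotPos_natCast {n : ℕ} (hn : 0 < n) : NumberField.IsTotPos K ((n : 𝓞 K) : K) := by
  intro w
  rw [NumberField.mixedEmbedding.mixedEmbedding_apply_isReal]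
  simp only [map_natCast]
  exact_mod_cast hn

omit [IsTotallyReal K] in
/-- **An ideal in the inverse narrow class**: `𝔟₀ · 𝔠₀ = (N𝔟₀)` with `N𝔟₀ ≫ 0`. [folklore] -/
theorem exists_inverse_class {𝔟₀ : Ideal (𝓞 K)} (h : 𝔟₀ ≠ ⊥) :
    ∃ 𝔠₀ : Ideal (𝓞 K), 𝔠₀ ≠ ⊥ ∧ nclass 𝔠₀ * nclass 𝔟₀ = 1 := by
  set b : 𝓞 K := (Ideal.absNorm 𝔟₀ : 𝓞 K) with hb
  have hbpos : 0 < Ideal.absNorm 𝔟₀ := Nat.pos_of_ne_zero (by rwa [Ne, Ideal.absNorm_eq_zero_iff])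
  have hbmem : b ∈ 𝔟₀ := Ideal.absNorm_mem 𝔟₀
  have hb0 : b ≠ 0 := by rw [hb]; exact_mod_cast hbpos.ne'
  have hdvd : 𝔟₀ ∣ Ideal.span {b} := Ideal.dvd_iff_le.2 ((Ideal.span_singleton_le_iff_mem _).2 hbmem)
  refine ⟨cofactor (Ideal.span {b}) 𝔟₀, cofactor_ne_bot (by rwa [Ne, Ideal.span_singleton_eq_bot]) hdvd, ?_⟩
  have hpp : IsPosPrincipal K (Ideal.span {b}) := ⟨b, hb0, isTotPos_natCast hbpos, rfl⟩
  have hsb : Ideal.span {b} ≠ ⊥ := by rwa [Ne, Ideal.span_singleton_eq_bot]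
  have hmul : nclass (𝔟₀ * cofactor (Ideal.span {b}) 𝔟₀) = nclass 𝔟₀ * nclass (cofactor (Ideal.span {b}) 𝔟₀) :=
    nclass_mul h (cofactor_ne_bot hsb hdvd)
  rw [mul_cofactor hdvd, (nclass_eq_one_iff hsb).2 hpp] at hmul
  have hc : nclass (cofactor (Ideal.span {b}) 𝔟₀) * nclass 𝔟₀ = nclass 𝔟₀ * nclass (cofactor (Ideal.span {b}) 𝔟₀) :=
    mul_comm (G := NCl K) _ _
  exact hc.trans hmul.symm

/-- **Balanced totally positive generators of the ideals of `P⁺`.** [cite: Hinz1988, §4 (4.14)] -/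
theorem exists_balanced_gen : ∃ Cb : ℝ, 1 ≤ Cb ∧ ∀ I : Ideal (𝓞 K), IsPosPrincipal K I →
    ∃ g : 𝓞 K, NumberField.IsTotPos K (g : K) ∧ Ideal.span {g} = I ∧
      ∀ w : RP, remb K (g : K) w ≤ Cb * (Ideal.absNorm (Ideal.span {g}) : ℝ) ^ ((d : ℝ)⁻¹) := by
  obtain ⟨Cb, hCb, h⟩ := exists_balanced_totPos (K := K)
  refine ⟨Cb, hCb, fun I hI => ?_⟩
  obtain ⟨hne, hpos, hspan⟩ := posGen_spec hI
  obtain ⟨u, -, hupos, hub⟩ := h (posGen I) hpos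
  refine ⟨(u : 𝓞 K) * posGen I, hupos, ?_, ?_⟩
  · rw [Ideal.span_singleton_mul_left_unit u.isUnit, ← hspan]
  · intro w
    have := hub w
    have hsp : Ideal.span {(u : 𝓞 K) * posGen I} = Ideal.span {posGen I} :=
      Ideal.span_singleton_mul_left_unit u.isUnit _
    rwa [hsp, ← one_div]

omit [IsTotallyReal K] in
/-- **The data of one narrow class** (Hinz, proof of (4.10)): primes `𝔭₁ ∈ ℭ⁻¹`, `𝔭₂ ∈ ℭ` of
norm `> Q`, a balanced totally positive generator `ρ₀` of `𝔭₁𝔭₂`, and balanced totally positive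
generators `gen 𝔟` of `𝔭₁𝔟` for every `𝔟 ∈ ℭ`. [cite: Hinz1988, §4 (4.11)–(4.14)] -/
theorem exists_classData {Cb : ℝ}
    (hCb : ∀ I : Ideal (𝓞 K), IsPosPrincipal K I → ∃ g : 𝓞 K, NumberField.IsTotPos K (g : K) ∧
      Ideal.span {g} = I ∧ ∀ w : RP, remb K (g : K) w ≤ Cb * (Ideal.absNorm (Ideal.span {g}) : ℝ) ^ ((d : ℝ)⁻¹))
    {𝔟₀ : Ideal (𝓞 K)} (h𝔟₀ : 𝔟₀ ≠ ⊥) (Q : ℝ) :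
    ∃ (v₁ v₂ : HeightOneSpectrum (𝓞 K)) (ρ₀ : 𝓞 K) (gen : Ideal (𝓞 K) → 𝓞 K),
      Q < (Ideal.absNorm v₁.asIdeal : ℝ) ∧ Q < (Ideal.absNorm v₂.asIdeal : ℝ) ∧
      Ideal.span {ρ₀} = v₁.asIdeal * v₂.asIdeal ∧ NumberField.IsTotPos K (ρ₀ : K) ∧
      (∀ w : RP, remb K (ρ₀ : K) w ≤ Cb * (Ideal.absNorm (Ideal.span {ρ₀}) : ℝ) ^ ((d : ℝ)⁻¹)) ∧
      ∀ 𝔟 : Ideal (𝓞 K), 𝔟 ≠ ⊥ → nclass 𝔟 = nclass 𝔟₀ →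
        NumberField.IsTotPos K (gen 𝔟 : K) ∧ Ideal.span {gen 𝔟} = v₁.asIdeal * 𝔟 ∧
          ∀ w : RP, remb K (gen 𝔟 : K) w ≤ Cb * (Ideal.absNorm (Ideal.span {gen 𝔟}) : ℝ) ^ ((d : ℝ)⁻¹) := by
  obtain ⟨𝔠₀, h𝔠₀, hinv⟩ := exists_inverse_class h𝔟₀
  obtain ⟨v₁, hv₁, hQ₁⟩ := exists_prime_nclass_eq h𝔠₀ Q
  obtain ⟨v₂, hv₂, hQ₂⟩ := exists_prime_nclass_eq h𝔟₀ Q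
  -- `𝔭₁𝔟 ∈ P⁺` for `𝔟 ∈ ℭ`
  have hpp : ∀ 𝔟 : Ideal (𝓞 K), 𝔟 ≠ ⊥ → nclass 𝔟 = nclass 𝔟₀ → IsPosPrincipal K (v₁.asIdeal * 𝔟) := by
    intro 𝔟 h𝔟 hcl
    rw [← nclass_eq_one_iff (mul_ne_zero v₁.ne_bot h𝔟), nclass_mul v₁.ne_bot h𝔟, hv₁, hcl, hinv]
  have hpp₁₂ : IsPosPrincipal K (v₁.asIdeal * v₂.asIdeal) := by
    rw [← nclass_eq_one_iff (mul_ne_zero v₁.ne_bot v₂.ne_bot), nclass_mul v₁.ne_bot v₂.ne_bot, hv₁, hv₂, hinv]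
  obtain ⟨ρ₀, hρpos, hρspan, hρbal⟩ := hCb _ hpp₁₂
  choose! gen hgen using fun 𝔟 (h : 𝔟 ≠ ⊥ ∧ nclass 𝔟 = nclass 𝔟₀) => hCb _ (hpp 𝔟 h.1 h.2)
  exact ⟨v₁, v₂, ρ₀, gen, hQ₁, hQ₂, hρspan, hρpos, hρbal, fun 𝔟 h𝔟 hcl => hgen 𝔟 ⟨h𝔟, hcl⟩⟩

omit [IsTotallyReal K] in
/-- Small moduli are prime to a prime of large norm. [folklore] -/
theorem isCoprime_of_absNorm_lt (v : HeightOneSpectrum (𝓞 K)) {𝔮 : Ideal (𝓞 K)} (h𝔮 : 𝔮 ≠ ⊥)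
    (hlt : (Ideal.absNorm 𝔮 : ℝ) < Ideal.absNorm v.asIdeal) : IsCoprime 𝔮 v.asIdeal := by
  rw [Ideal.isCoprime_iff_sup_eq]
  by_contra hne
  have hmax : v.asIdeal.IsMaximal := v.isPrime.isMaximal v.ne_bot
  have heq := hmax.eq_of_le hne le_sup_right
  have hle : 𝔮 ≤ v.asIdeal := heq ▸ le_sup_left
  have hpos : 0 < Ideal.absNorm 𝔮 := Nat.pos_of_ne_zero (by rwa [Ne, Ideal.absNorm_eq_zero_iff])
  have := Nat.le_of_dvd hpos (Ideal.absNorm_dvd_absNorm_of_le hle)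
  have : (Ideal.absNorm v.asIdeal : ℝ) ≤ Ideal.absNorm 𝔮 := by exact_mod_cast this
  linarith

/-! ## The blocks of large `N𝔟` vanish -/

/-- **Blocks with `N𝔟 > M^d/U` vanish**: for `𝔟 ∣ (α)`, `α ∈ A₀(M)`, `(α) ≠ 𝔟`, `N𝔟 > M^d/U`
(`U > 0`) one has `N((α)/𝔟) < U`, so `e_U((α)/𝔟) = [(α)/𝔟 = 1] = 0`. [cite: Hinz1988, §4 (4.10)] -/
theorem S4block_filter_large {𝔮 : Ideal (𝓞 K)} (χ : AddChar (Additive ((𝓞 K ⧸ 𝔮)ˣ)) ℂ) (k : ℝ → ℂ)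
    {M U : ℝ} (hU : 0 < U) (Bl : Finset (Ideal (𝓞 K))) (hBl : ∀ 𝔟 ∈ Bl, 𝔟 ≠ ⊥) :
    S4block K χ k M U Bl (cubeF K M) =
      S4block K χ k M U (Bl.filter fun 𝔟 => (Ideal.absNorm 𝔟 : ℝ) ≤ M ^ d / U) (cubeF K M) := by
  unfold S4block
  rw [Finset.sum_filter]
  refine Finset.sum_congr rfl fun 𝔟 h𝔟 => ?_
  split_ifs with hle
  · rfl
  · push Not at hle
    rw [Finset.sum_eq_zero, mul_zero]
    intro α hα
    rw [Finset.mem_filter] at hα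
    obtain ⟨hαc, hdvd, hcof⟩ := hα
    have hα0 : Ideal.span {α} ≠ ⊥ := by
      rw [Ne, Ideal.span_singleton_eq_bot]; exact ne_zero_of_mem_box₀ (mem_cubeF.1 hαc)
    obtain ⟨_, _, hNα⟩ := span_mem_idealFamily (K := K) (mem_cubeF.1 hαc)
    have hN𝔟 := absNorm_pos_of_ne_bot (hBl 𝔟 h𝔟)
    have hcne : cofactor (Ideal.span {α}) 𝔟 ≠ ⊥ := cofactor_ne_bot hα0 hdvd
    have hNc : (Ideal.absNorm (cofactor (Ideal.span {α}) 𝔟) : ℝ) ≤ U := by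
      have hmul : (Ideal.absNorm (Ideal.span {α}) : ℝ) = Ideal.absNorm 𝔟 * Ideal.absNorm (cofactor (Ideal.span {α}) 𝔟) := by
        conv_lhs => rw [← mul_cofactor hdvd]
        rw [map_mul, Nat.cast_mul]
      have h1 : Ideal.absNorm 𝔟 * (Ideal.absNorm (cofactor (Ideal.span {α}) 𝔟) : ℝ) ≤ M ^ d := hmul ▸ hNα
      have h2 : M ^ d < Ideal.absNorm 𝔟 * U := by rwa [div_lt_iff₀ hU] at hle
      nlinarith
    rw [eU_eq_of_absNorm_le hcne hNc, if_neg hcof]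
    simp

/-! ## Decomposition into narrow classes and dyadic ranges -/

omit [IsTotallyReal K] in
/-- `S₄`-blocks are additive in the block. [folklore] -/
theorem S4block_sum_fiberwise {ι : Type*} [DecidableEq ι] {𝔮 : Ideal (𝓞 K)} (χ : AddChar (Additive ((𝓞 K ⧸ 𝔮)ˣ)) ℂ)
    (k : ℝ → ℂ) (M U : ℝ) (Bl : Finset (Ideal (𝓞 K))) (B : Finset (𝓞 K)) (T : Finset ι)
    (g : Ideal (𝓞 K) → ι) (hg : ∀ 𝔟 ∈ Bl, g 𝔟 ∈ T) :
    S4block K χ k M U Bl B = ∑ t ∈ T, S4block K χ k M U (Bl.filter fun 𝔟 => g 𝔟 = t) B := by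
  unfold S4block
  exact (Finset.sum_fiberwise_of_maps_to hg _).symm

/-- The dyadic index of an ideal, `j(𝔟) = ⌊log₂ N𝔟⌋`, so that `2^j ≤ N𝔟 < 2^{j+1}`. [folklore] -/
def dyad (𝔟 : Ideal (𝓞 K)) : ℕ := Nat.log 2 (Ideal.absNorm 𝔟)

omit [IsTotallyReal K] in
/-- `2^{j(𝔟)} ≤ N𝔟 < 2^{j(𝔟)+1}` for `𝔟 ≠ 0`. [folklore] -/
theorem dyad_spec {𝔟 : Ideal (𝓞 K)} (h : 𝔟 ≠ ⊥) :
    (2 : ℝ) ^ dyad 𝔟 ≤ Ideal.absNorm 𝔟 ∧ (Ideal.absNorm 𝔟 : ℝ) < 2 ^ (dyad 𝔟 + 1) := by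
  have hpos : Ideal.absNorm 𝔟 ≠ 0 := by rwa [Ne, Ideal.absNorm_eq_zero_iff]
  constructor
  · exact_mod_cast Nat.pow_log_le_self 2 hpos
  · exact_mod_cast Nat.lt_pow_succ_log_self (by norm_num) _

omit [IsTotallyReal K] in
/-- The dyadic index is `≤ log₂` of any upper bound for the norm. [folklore] -/
theorem dyad_lt_of_le {𝔟 : Ideal (𝓞 K)} (h : 𝔟 ≠ ⊥) {X : ℝ} {J : ℕ} (hX : (Ideal.absNorm 𝔟 : ℝ) ≤ X)
    (hJ : X < 2 ^ J) : dyad 𝔟 < J := by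
  have h1 := (dyad_spec h).1
  by_contra hle
  push Not at hle
  have : (2 : ℝ) ^ J ≤ 2 ^ dyad 𝔟 := pow_le_pow_right₀ (by norm_num) hle
  linarith

/-! ## Elementary real inequalities -/

omit [NumberField K] [IsTotallyReal K] in
/-- `√((P² + x) y) ≤ (P + √x) √y` for `P, x, y ≥ 0`. [folklore] -/
theorem sqrt_sq_add_mul_le {P x y : ℝ} (hP : 0 ≤ P) (hx : 0 ≤ x) :
    Real.sqrt ((P ^ 2 + x) * y) ≤ (P + Real.sqrt x) * Real.sqrt y := by
  rw [Real.sqrt_mul (by positivity)]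
  refine mul_le_mul_of_nonneg_right ?_ (Real.sqrt_nonneg _)
  rw [Real.sqrt_le_left (by positivity)]
  have hsx := Real.sq_sqrt hx
  nlinarith [Real.sqrt_nonneg x, mul_nonneg hP (Real.sqrt_nonneg x)]

omit [NumberField K] [IsTotallyReal K] in
/-- `Nat.log 2 ⌊Q⌋ ≤ 2 log Q` for `Q ≥ 1`. [folklore] -/
theorem natLog_le_two_mul_log {Q : ℝ} (hQ : 1 ≤ Q) : (Nat.log 2 ⌊Q⌋₊ : ℝ) ≤ 2 * Real.log Q := by
  have hQ0 : 0 < Q := by linarith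
  have h1 : (2 : ℝ) ^ Nat.log 2 ⌊Q⌋₊ ≤ Q := by
    have hfl : 0 < ⌊Q⌋₊ := Nat.floor_pos.2 hQ
    have := Nat.pow_log_le_self 2 hfl.ne'
    calc (2 : ℝ) ^ Nat.log 2 ⌊Q⌋₊ = ((2 ^ Nat.log 2 ⌊Q⌋₊ : ℕ) : ℝ) := by push_cast; ring
      _ ≤ (⌊Q⌋₊ : ℝ) := by exact_mod_cast this
      _ ≤ Q := Nat.floor_le hQ0.le
  have h2 := Real.log_le_log (by positivity) h1
  rw [Real.log_pow] at h2
  have hlog2 : (1 : ℝ) / 2 < Real.log 2 := by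
    have := Real.log_two_gt_d9; norm_num at this ⊢; linarith
  have hn : (0 : ℝ) ≤ Nat.log 2 ⌊Q⌋₊ := Nat.cast_nonneg _
  nlinarith

omit [NumberField K] [IsTotallyReal K] in
/-- `∑_{i ≤ I₀} 2^{i+1} ≤ 4 · 2^{I₀}`. [folklore] -/
theorem sum_two_pow_succ_le (I₀ : ℕ) : ∑ i ∈ Finset.range (I₀ + 1), (2 : ℝ) ^ (i + 1) ≤ 4 * 2 ^ I₀ := by
  induction I₀ with
  | zero => norm_num
  | succ n ih =>
    rw [Finset.sum_range_succ, pow_succ]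
    nlinarith [pow_pos (two_pos : (0 : ℝ) < 2) (n + 1), pow_succ (2 : ℝ) n]

omit [NumberField K] [IsTotallyReal K] in
/-- `∑_{i₀ ≤ i < i₀ + N} 2^{-(i+1)} ≤ 2^{-i₀}`. [folklore] -/
theorem sum_two_pow_inv_le (i₀ N : ℕ) :
    ∑ i ∈ Finset.Ico i₀ (i₀ + N), ((2 : ℝ) ^ (i + 1))⁻¹ ≤ ((2 : ℝ) ^ i₀)⁻¹ := by
  rw [Finset.sum_Ico_eq_sum_range, Nat.add_sub_cancel_left]
  have hterm : ∀ m ∈ Finset.range N, ((2 : ℝ) ^ (i₀ + m + 1))⁻¹ = ((2 : ℝ) ^ i₀)⁻¹ * ((1 / 2) * (1 / 2) ^ m) := by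
    intro m _
    rw [pow_succ, pow_add, mul_inv, mul_inv, one_div, inv_pow]; ring
  rw [Finset.sum_congr rfl hterm, ← Finset.mul_sum, ← Finset.mul_sum]
  refine mul_le_of_le_one_right (by positivity) ?_
  have hgeom : ∑ m ∈ Finset.range N, ((1 : ℝ) / 2) ^ m ≤ 2 := by
    have := geom_sum_eq (x := (1 : ℝ) / 2) (by norm_num) N
    rw [this]
    have h1 : (0 : ℝ) ≤ (1 / 2) ^ N := by positivity
    have h2 : ((1 : ℝ) / 2) ^ N ≤ 1 := pow_le_one₀ (by norm_num) (by norm_num)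
    rw [div_le_iff_of_neg (by norm_num)]
    nlinarith
  nlinarith

/-! ## The dyadic decomposition of the moduli -/

omit [IsTotallyReal K] in
/-- `φ(𝔮) > 0` as a real number (for `𝔮 ≠ 0`). [folklore] -/
theorem card_units_pos {𝔮 : Ideal (𝓞 K)} (h𝔮 : 𝔮 ≠ ⊥) : (0 : ℝ) < Nat.card ((𝓞 K ⧸ 𝔮)ˣ) := by
  haveI : Finite (𝓞 K ⧸ 𝔮) := Ideal.finiteQuotientOfFreeOfNeBot 𝔮 h𝔮
  exact_mod_cast Nat.card_pos

omit [IsTotallyReal K] in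
/-- **Dyadic decomposition of the moduli** (Hinz p. 188, "(4.20) … after summation over `P = 2^ν`"):
if for every level `1 ≤ P ≤ 2Q` one has `∑_{N𝔮≤P} (N𝔮/φ(𝔮)) X(𝔮) ≤ G (P + s)(P + t)` with
`G, s, t ≥ 0`, then
`∑_{Q₁<N𝔮≤Q} X(𝔮)/φ(𝔮) ≤ 2G (4Q + (2 log Q + 1)(s + t) + 2st/Q₁)`. [cite: Hinz1988, §4 (4.20)] -/
theorem dyadic_moduli {X : Ideal (𝓞 K) → ℝ} (hX : ∀ 𝔮, 0 ≤ X 𝔮) {Q₁ Q G s t : ℝ} (hQ₁ : 1 ≤ Q₁)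
    (hQ : Q₁ ≤ Q) (hG : 0 ≤ G) (hs : 0 ≤ s) (ht : 0 ≤ t)
    (hF : ∀ P : ℝ, 1 ≤ P → P ≤ 2 * Q →
      ∑ 𝔮 ∈ idealsLE K P, (Ideal.absNorm 𝔮 : ℝ) / Nat.card ((𝓞 K ⧸ 𝔮)ˣ) * X 𝔮 ≤ G * ((P + s) * (P + t))) :
    ∑ 𝔮 ∈ (idealsLE K Q).filter (fun 𝔮 => Q₁ < Ideal.absNorm 𝔮), X 𝔮 / Nat.card ((𝓞 K ⧸ 𝔮)ˣ) ≤
      2 * G * (4 * Q + (2 * Real.log Q + 1) * (s + t) + 2 * (s * t) / Q₁) := by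
  have hQ1 : 1 ≤ Q := hQ₁.trans hQ
  have hQ0 : 0 < Q := by linarith
  have hQ₁0 : 0 < Q₁ := by linarith
  set S := (idealsLE K Q).filter (fun 𝔮 => Q₁ < Ideal.absNorm 𝔮) with hS
  set I₀ := Nat.log 2 ⌊Q⌋₊ with hI₀
  set i₀ := Nat.log 2 ⌊Q₁⌋₊ with hi₀
  set Iset := (Finset.range (I₀ + 1)).filter (fun i => Q₁ < (2 : ℝ) ^ (i + 1) ∧ (2 : ℝ) ^ i ≤ Q) with hIset
  -- every modulus lands in `Iset`
  have hmaps : ∀ 𝔮 ∈ S, dyad 𝔮 ∈ Iset := by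
    intro 𝔮 h𝔮
    rw [hS, Finset.mem_filter, mem_idealsLE] at h𝔮
    obtain ⟨⟨h0, hle⟩, hlt⟩ := h𝔮
    obtain ⟨h1, h2⟩ := dyad_spec h0
    rw [hIset, Finset.mem_filter, Finset.mem_range]
    refine ⟨Nat.lt_succ_of_le ?_, lt_of_lt_of_le hlt h2.le, h1.trans hle⟩
    rw [hI₀]
    refine Nat.log_mono_right ?_
    exact Nat.le_floor hle
  rw [← Finset.sum_fiberwise_of_maps_to hmaps]
  -- the fibre over `i`
  have hfib : ∀ i ∈ Iset, ∑ 𝔮 ∈ S.filter (fun 𝔮 => dyad 𝔮 = i), X 𝔮 / Nat.card ((𝓞 K ⧸ 𝔮)ˣ) ≤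
      2 / (2 : ℝ) ^ (i + 1) * (G * (((2 : ℝ) ^ (i + 1) + s) * ((2 : ℝ) ^ (i + 1) + t))) := by
    intro i hi
    rw [hIset, Finset.mem_filter] at hi
    obtain ⟨-, hiQ₁, hiQ⟩ := hi
    have hP1 : (1 : ℝ) ≤ 2 ^ (i + 1) := one_le_pow₀ (by norm_num)
    have hP2 : (2 : ℝ) ^ (i + 1) ≤ 2 * Q := by rw [pow_succ]; linarith
    have hFi := hF _ hP1 hP2
    calc ∑ 𝔮 ∈ S.filter (fun 𝔮 => dyad 𝔮 = i), X 𝔮 / Nat.card ((𝓞 K ⧸ 𝔮)ˣ)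
        ≤ ∑ 𝔮 ∈ S.filter (fun 𝔮 => dyad 𝔮 = i),
            2 / (2 : ℝ) ^ (i + 1) * ((Ideal.absNorm 𝔮 : ℝ) / Nat.card ((𝓞 K ⧸ 𝔮)ˣ) * X 𝔮) := by
          refine Finset.sum_le_sum fun 𝔮 h𝔮 => ?_
          rw [Finset.mem_filter, hS, Finset.mem_filter, mem_idealsLE] at h𝔮
          obtain ⟨⟨⟨h0, -⟩, -⟩, hdy⟩ := h𝔮
          have hφ := card_units_pos h0
          have h1 := (dyad_spec h0).1
          rw [hdy] at h1
          have hN : (0 : ℝ) < Ideal.absNorm 𝔮 := absNorm_pos_of_ne_bot h0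
          -- `1/φ ≤ (2/2^{i+1}) · N𝔮/φ` since `2^i ≤ N𝔮`
          rw [div_eq_mul_inv, show 2 / (2 : ℝ) ^ (i + 1) * ((Ideal.absNorm 𝔮 : ℝ) / Nat.card ((𝓞 K ⧸ 𝔮)ˣ) * X 𝔮) =
            X 𝔮 * ((2 / (2 : ℝ) ^ (i + 1) * Ideal.absNorm 𝔮) * (Nat.card ((𝓞 K ⧸ 𝔮)ˣ) : ℝ)⁻¹) by ring]
          refine mul_le_mul_of_nonneg_left ?_ (hX 𝔮)
          refine le_mul_of_one_le_left (by positivity) ?_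
          rw [pow_succ, div_mul_eq_mul_div, le_div_iff₀ (by positivity)]
          linarith
      _ = 2 / (2 : ℝ) ^ (i + 1) * ∑ 𝔮 ∈ S.filter (fun 𝔮 => dyad 𝔮 = i),
            (Ideal.absNorm 𝔮 : ℝ) / Nat.card ((𝓞 K ⧸ 𝔮)ˣ) * X 𝔮 := by rw [Finset.mul_sum]
      _ ≤ 2 / (2 : ℝ) ^ (i + 1) * ∑ 𝔮 ∈ idealsLE K ((2 : ℝ) ^ (i + 1)),
            (Ideal.absNorm 𝔮 : ℝ) / Nat.card ((𝓞 K ⧸ 𝔮)ˣ) * X 𝔮 := by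
          refine mul_le_mul_of_nonneg_left ?_ (by positivity)
          refine Finset.sum_le_sum_of_subset_of_nonneg ?_ fun 𝔮 _ _ => ?_
          · intro 𝔮 h𝔮
            rw [Finset.mem_filter, hS, Finset.mem_filter, mem_idealsLE] at h𝔮
            obtain ⟨⟨⟨h0, -⟩, -⟩, hdy⟩ := h𝔮
            rw [mem_idealsLE]
            have := (dyad_spec h0).2
            rw [hdy] at this
            exact ⟨h0, this.le⟩
          · exact mul_nonneg (div_nonneg (Nat.cast_nonneg _) (Nat.cast_nonneg _)) (hX 𝔮)
      _ ≤ _ := mul_le_mul_of_nonneg_left hFi (by positivity)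
  refine (Finset.sum_le_sum hfib).trans ?_
  -- `(2/P) G (P+s)(P+t) = 2G (P + (s+t) + st/P)`
  have hexp : ∀ i ∈ Iset, 2 / (2 : ℝ) ^ (i + 1) * (G * (((2 : ℝ) ^ (i + 1) + s) * ((2 : ℝ) ^ (i + 1) + t))) =
      2 * G * ((2 : ℝ) ^ (i + 1) + (s + t) + s * t * ((2 : ℝ) ^ (i + 1))⁻¹) := by
    intro i _
    have hP : (2 : ℝ) ^ (i + 1) ≠ 0 := by positivity
    field_simp
    ring
  rw [Finset.sum_congr rfl hexp, ← Finset.mul_sum, Finset.sum_add_distrib, Finset.sum_add_distrib,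
    Finset.sum_const, nsmul_eq_mul, ← Finset.mul_sum]
  refine mul_le_mul_of_nonneg_left ?_ (by positivity)
  -- the three sums
  have hsum₁ : ∑ i ∈ Iset, (2 : ℝ) ^ (i + 1) ≤ 4 * Q := by
    have hsub : Iset ⊆ Finset.range (Nat.log 2 ⌊Q⌋₊ + 1) := Finset.filter_subset _ _
    refine (Finset.sum_le_sum_of_subset_of_nonneg hsub fun i _ _ => by positivity).trans ?_
    refine (sum_two_pow_succ_le _).trans ?_
    have h1 : (2 : ℝ) ^ Nat.log 2 ⌊Q⌋₊ ≤ Q := by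
      have hfl : 0 < ⌊Q⌋₊ := Nat.floor_pos.2 hQ1
      have := Nat.pow_log_le_self 2 hfl.ne'
      calc (2 : ℝ) ^ Nat.log 2 ⌊Q⌋₊ = ((2 ^ Nat.log 2 ⌊Q⌋₊ : ℕ) : ℝ) := by push_cast; ring
        _ ≤ (⌊Q⌋₊ : ℝ) := by exact_mod_cast this
        _ ≤ Q := Nat.floor_le hQ0.le
    linarith
  have hcard : (Iset.card : ℝ) ≤ 2 * Real.log Q + 1 := by
    have h1 : Iset.card ≤ I₀ + 1 := (Finset.card_le_card (Finset.filter_subset _ _)).trans (by simp)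
    have h2 : (Iset.card : ℝ) ≤ I₀ + 1 := by exact_mod_cast h1
    have h3 := natLog_le_two_mul_log hQ1
    rw [← hI₀] at h3
    linarith
  have hsum₃ : ∑ i ∈ Iset, ((2 : ℝ) ^ (i + 1))⁻¹ ≤ 2 / Q₁ := by
    -- `Iset ⊆ [i₀, i₀ + I₀ + 1)` and `2^{-i₀} ≤ 2/Q₁`
    have hsub : Iset ⊆ Finset.Ico i₀ (i₀ + (I₀ + 1)) := by
      intro i hi
      rw [hIset, Finset.mem_filter, Finset.mem_range] at hi
      obtain ⟨hiI, hiQ₁, -⟩ := hi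
      rw [Finset.mem_Ico]
      refine ⟨?_, by omega⟩
      by_contra hlt
      push Not at hlt
      have h1 : (2 : ℝ) ^ (i + 1) ≤ 2 ^ i₀ := pow_le_pow_right₀ (by norm_num) hlt
      have h2 : (2 : ℝ) ^ i₀ ≤ Q₁ := by
        have hfl : 0 < ⌊Q₁⌋₊ := Nat.floor_pos.2 hQ₁
        have := Nat.pow_log_le_self 2 hfl.ne'
        calc (2 : ℝ) ^ i₀ = ((2 ^ Nat.log 2 ⌊Q₁⌋₊ : ℕ) : ℝ) := by rw [hi₀]; push_cast; ring
          _ ≤ (⌊Q₁⌋₊ : ℝ) := by exact_mod_cast this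
          _ ≤ Q₁ := Nat.floor_le hQ₁0.le
      linarith
    refine (Finset.sum_le_sum_of_subset_of_nonneg hsub fun i _ _ => by positivity).trans ?_
    refine (sum_two_pow_inv_le i₀ (I₀ + 1)).trans ?_
    -- `2^{i₀+1} > Q₁`
    have hgt : Q₁ < (2 : ℝ) ^ (i₀ + 1) := by
      have := Nat.lt_pow_succ_log_self (b := 2) (by norm_num) ⌊Q₁⌋₊
      rw [← hi₀] at this
      calc Q₁ < (⌊Q₁⌋₊ : ℝ) + 1 := Nat.lt_floor_add_one Q₁
        _ ≤ ((2 ^ (i₀ + 1) : ℕ) : ℝ) := by exact_mod_cast this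
        _ = (2 : ℝ) ^ (i₀ + 1) := by push_cast; ring
    rw [inv_le_comm₀ (by positivity) (by positivity), inv_div]
    rw [pow_succ] at hgt
    linarith
  have hst : 0 ≤ s * t := mul_nonneg hs ht
  calc ∑ i ∈ Iset, (2 : ℝ) ^ (i + 1) + (Iset.card : ℝ) * (s + t) + s * t * ∑ i ∈ Iset, ((2 : ℝ) ^ (i + 1))⁻¹
      ≤ 4 * Q + (2 * Real.log Q + 1) * (s + t) + s * t * (2 / Q₁) := by
        gcongr
    _ = 4 * Q + (2 * Real.log Q + 1) * (s + t) + 2 * (s * t) / Q₁ := by ring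

/-! ## The algebra of the block bound -/

omit [NumberField K] [IsTotallyReal K] in
/-- The real-variable bookkeeping behind (4.20): with `B₁ ≤ (log M')² C_I M'`, `M'Y = bM^d`,
`Y ≤ bM^d/U`, `M' ≤ 2M^d/U`. [cite: Hinz1988, §4 (4.20)] -/
theorem block_algebra {C₀ Kk CI a b L H3 Md U Q Q₁ NI M' B₁ Y lM : ℝ} (hC₀ : 0 ≤ C₀) (hKk : 0 ≤ Kk)
    (hCI : 0 ≤ CI) (ha : 0 ≤ a) (hb : 0 ≤ b) (hL : 0 ≤ L) (hH3 : 0 ≤ H3) (hMd : 0 ≤ Md) (hU : 0 < U)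
    (hQ : 0 ≤ Q) (hQ₁ : 0 < Q₁) (hNI : 0 ≤ NI) (hM' : 0 ≤ M') (hY0 : 0 ≤ Y) (hlM : 0 ≤ lM)
    (hB₁ : B₁ ≤ lM ^ 2 * (CI * M')) (hY : M' * Y = b * Md) (hYU : Y ≤ b * Md / U) (hM'U : M' ≤ 2 * Md / U) :
    2 * (C₀ * Kk * Real.sqrt (B₁ * (L * Y * H3))) *
        (4 * Q + NI * (Real.sqrt (a * M') + Real.sqrt Y) + 2 * (Real.sqrt (a * M') * Real.sqrt Y) / Q₁) ≤
      2 * C₀ * Real.sqrt (CI * b) * Kk * lM * Real.sqrt (L * H3) *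
        (4 * Q * Real.sqrt Md + NI * (Real.sqrt (2 * a) + Real.sqrt b) * (Md / Real.sqrt U) +
          2 * Real.sqrt (a * b) * (Md / Q₁)) := by
  have hsMd := Real.sqrt_nonneg Md
  have hMd' : Real.sqrt Md * Real.sqrt Md = Md := Real.mul_self_sqrt hMd
  -- `√(B₁ L Y H3) ≤ lM √(CI b) √Md √(L H3)`
  have h1 : Real.sqrt (B₁ * (L * Y * H3)) ≤ lM * Real.sqrt (CI * b) * Real.sqrt Md * Real.sqrt (L * H3) := by
    have hle : B₁ * (L * Y * H3) ≤ (lM * Real.sqrt (CI * b) * Real.sqrt Md * Real.sqrt (L * H3)) ^ 2 := by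
      have hsq1 : Real.sqrt (CI * b) ^ 2 = CI * b := Real.sq_sqrt (by positivity)
      have hsq2 : Real.sqrt Md ^ 2 = Md := Real.sq_sqrt hMd
      have hsq3 : Real.sqrt (L * H3) ^ 2 = L * H3 := Real.sq_sqrt (by positivity)
      calc B₁ * (L * Y * H3) ≤ lM ^ 2 * (CI * M') * (L * Y * H3) :=
            mul_le_mul_of_nonneg_right hB₁ (by positivity)
        _ = lM ^ 2 * (CI * (M' * Y)) * (L * H3) := by ring
        _ = lM ^ 2 * (CI * b) * Md * (L * H3) := by rw [hY]; ring
        _ = _ := by rw [mul_pow, mul_pow, mul_pow, hsq1, hsq2, hsq3]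
    calc Real.sqrt (B₁ * (L * Y * H3)) ≤ Real.sqrt ((lM * Real.sqrt (CI * b) * Real.sqrt Md * Real.sqrt (L * H3)) ^ 2) :=
          Real.sqrt_le_sqrt hle
      _ = _ := Real.sqrt_sq (by positivity)
  -- `√(aM') √Md ≤ √(2a) Md/√U`, `√Y √Md ≤ √b Md/√U`, `√(aM') √Y = √(ab) √Md`
  have hsU := Real.sqrt_pos.2 hU
  have hUs : Real.sqrt U * Real.sqrt U = U := Real.mul_self_sqrt hU.le
  have h2 : Real.sqrt (a * M') * Real.sqrt Md ≤ Real.sqrt (2 * a) * (Md / Real.sqrt U) := by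
    rw [mul_div_assoc', le_div_iff₀ hsU, ← Real.sqrt_mul (by positivity), ← Real.sqrt_mul (by positivity)]
    calc Real.sqrt (a * M' * Md * U) ≤ Real.sqrt ((Real.sqrt (2 * a) * Md) ^ 2) := by
          refine Real.sqrt_le_sqrt ?_
          have : M' * U ≤ 2 * Md := by rwa [le_div_iff₀ hU] at hM'U
          rw [mul_pow, Real.sq_sqrt (by positivity)]
          nlinarith [mul_nonneg ha hMd]
      _ = Real.sqrt (2 * a) * Md := Real.sqrt_sq (by positivity)
  have h3 : Real.sqrt Y * Real.sqrt Md ≤ Real.sqrt b * (Md / Real.sqrt U) := by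
    rw [mul_div_assoc', le_div_iff₀ hsU, ← Real.sqrt_mul hY0, ← Real.sqrt_mul (by positivity)]
    calc Real.sqrt (Y * Md * U) ≤ Real.sqrt ((Real.sqrt b * Md) ^ 2) := by
          refine Real.sqrt_le_sqrt ?_
          have : Y * U ≤ b * Md := by rwa [le_div_iff₀ hU] at hYU
          rw [mul_pow, Real.sq_sqrt hb]
          nlinarith
      _ = Real.sqrt b * Md := Real.sqrt_sq (by positivity)
  have h4 : Real.sqrt (a * M') * Real.sqrt Y * Real.sqrt Md = Real.sqrt (a * b) * Md := by
    rw [← Real.sqrt_mul (by positivity), show a * M' * Y = a * (M' * Y) by ring, hY,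
      show a * (b * Md) = a * b * Md by ring, Real.sqrt_mul (by positivity), mul_assoc, hMd']
  -- combine
  set s := Real.sqrt (a * M') with hs
  set t := Real.sqrt Y with ht
  set R := Real.sqrt (L * H3) with hR
  set V := Real.sqrt (CI * b) with hV
  have hs0 : 0 ≤ s := Real.sqrt_nonneg _
  have ht0 : 0 ≤ t := Real.sqrt_nonneg _
  have hR0 : 0 ≤ R := Real.sqrt_nonneg _
  have hV0 : 0 ≤ V := Real.sqrt_nonneg _
  have hbr : 0 ≤ 4 * Q + NI * (s + t) + 2 * (s * t) / Q₁ := by positivity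
  calc 2 * (C₀ * Kk * Real.sqrt (B₁ * (L * Y * H3))) * (4 * Q + NI * (s + t) + 2 * (s * t) / Q₁)
      ≤ 2 * (C₀ * Kk * (lM * V * Real.sqrt Md * R)) * (4 * Q + NI * (s + t) + 2 * (s * t) / Q₁) := by
        gcongr
    _ = 2 * C₀ * V * Kk * lM * R * (4 * Q * Real.sqrt Md + NI * (s * Real.sqrt Md + t * Real.sqrt Md) +
          2 * (s * t * Real.sqrt Md) / Q₁) := by ring
    _ ≤ 2 * C₀ * V * Kk * lM * R * (4 * Q * Real.sqrt Md + NI * (Real.sqrt (2 * a) * (Md / Real.sqrt U) +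
          Real.sqrt b * (Md / Real.sqrt U)) + 2 * (Real.sqrt (a * b) * Md) / Q₁) := by
        rw [h4]
        gcongr
    _ = _ := by ring

/-! ## The uniform bound for one block -/

omit [IsTotallyReal K] in
/-- `S₄`-blocks over the empty block vanish. [folklore] -/
theorem S4block_empty {𝔮 : Ideal (𝓞 K)} (χ : AddChar (Additive ((𝓞 K ⧸ 𝔮)ˣ)) ℂ) (k : ℝ → ℂ) (M U : ℝ)
    (B : Finset (𝓞 K)) : S4block K χ k M U ∅ B = 0 := by
  unfold S4block; exact Finset.sum_empty

/-! ### The constants -/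

variable (K) in
/-- The constant of `TypeTwoBlock.block_bound`. [folklore] -/
def Cblk : ℝ := (block_bound (K := K)).choose

/-- Specification of `Cblk` (the statement of `TypeTwoBlock.block_bound`). [cite: Hinz1988, §4 (4.20)] -/
theorem Cblk_spec : 0 < Cblk K ∧
    ∀ (k : ℝ → ℂ), ContDiff ℝ 2 k → HasCompactSupport k → (∀ v, 0 < v → k v = 0) →
    ∀ (M : ℝ), 1 ≤ M → ∀ (U P : ℝ), 1 ≤ P → ∀ (Cb : ℝ), 1 ≤ Cb → ∀ (M' : ℝ), 1 ≤ M' → M' ≤ 2 * M ^ d →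
    ∀ (𝔭₁ 𝔭₂ : Ideal (𝓞 K)) (ρ₀ : 𝓞 K), 𝔭₁ ≠ ⊥ → 𝔭₂ ≠ ⊥ →
      Ideal.span {ρ₀} = 𝔭₁ * 𝔭₂ → NumberField.IsTotPos K (ρ₀ : K) →
      (∀ w : RP, remb K (ρ₀ : K) w ≤ Cb * (Ideal.absNorm (Ideal.span {ρ₀}) : ℝ) ^ ((d : ℝ)⁻¹)) →
    ∀ (Bl : Finset (Ideal (𝓞 K))) (gen : Ideal (𝓞 K) → 𝓞 K),
      (∀ 𝔟 ∈ Bl, 𝔟 ≠ ⊥ ∧ M' / 2 ≤ Ideal.absNorm 𝔟 ∧ (Ideal.absNorm 𝔟 : ℝ) ≤ M') →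
      (∀ 𝔟 ∈ Bl, NumberField.IsTotPos K (gen 𝔟 : K) ∧ Ideal.span {gen 𝔟} = 𝔭₁ * 𝔟 ∧
        ∀ w : RP, remb K (gen 𝔟 : K) w ≤ Cb * (Ideal.absNorm (Ideal.span {gen 𝔟}) : ℝ) ^ ((d : ℝ)⁻¹)) →
    ∑ 𝔮 ∈ (idealsLE K P).filter (fun 𝔮 => IsCoprime 𝔮 𝔭₁ ∧ IsCoprime 𝔮 𝔭₂),
        (Ideal.absNorm 𝔮 : ℝ) / Nat.card ((𝓞 K ⧸ 𝔮)ˣ) *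
          ∑ χ ∈ primChars K 𝔮, ‖S4block K χ k M U Bl (cubeF K M)‖ ≤
      Cblk K * (∫ τ, ‖𝓕 k τ‖) ^ d *
        (Real.sqrt ((P ^ 2 + Cb ^ d * M') * (Real.log M' ^ 2 * Bl.card)) *
          Real.sqrt ((P ^ 2 + 2 * Cb ^ (d * d) * M ^ d / M') *
            ((1 + Real.log (2 * Cb ^ (d * d) * M ^ d) / d) ^ rk * (2 * Cb ^ (d * d) * M ^ d / M') *
              harmU K U ^ 3))) :=
  (block_bound (K := K)).choose_spec

variable (K) in
/-- The balancing constant of `exists_balanced_gen`. [folklore] -/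
def Cbal : ℝ := (exists_balanced_gen (K := K)).choose

/-- Specification of `Cbal` (the statement of `exists_balanced_gen`). [cite: Hinz1988, §4 (4.14)] -/
theorem Cbal_spec : 1 ≤ Cbal K ∧ ∀ I : Ideal (𝓞 K), IsPosPrincipal K I →
    ∃ g : 𝓞 K, NumberField.IsTotPos K (g : K) ∧ Ideal.span {g} = I ∧
      ∀ w : RP, remb K (g : K) w ≤ Cbal K * (Ideal.absNorm (Ideal.span {g}) : ℝ) ^ ((d : ℝ)⁻¹) :=
  (exists_balanced_gen (K := K)).choose_spec

variable (K) in
/-- The constant of the linear ideal count. [folklore] -/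
def Cidl : ℝ := (card_idealsLE_le_linear K).choose

omit [IsTotallyReal K] in
/-- Specification of `Cidl`. [folklore] -/
theorem Cidl_spec : 0 < Cidl K ∧ ∀ x : ℝ, 0 ≤ x → ((idealsLE K x).card : ℝ) ≤ Cidl K * x :=
  (card_idealsLE_le_linear K).choose_spec

set_option maxHeartbeats 800000 in
-- the proof threads the block data and the dyadic decomposition at once
/-- **The raw bound for one block** (one narrow class, one dyadic index `j`, `U < N𝔟 ≤ M^d/U`,
`Bl ≠ ∅`): the outcome of `block_bound` + `dyadic_moduli` + `block_algebra`.
[cite: Hinz1988, §4 (4.20)] -/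
theorem classBlock_raw (k : ℝ → ℂ) (hk : ContDiff ℝ 2 k) (hks : HasCompactSupport k)
    (hk0 : ∀ v, 0 < v → k v = 0) {M U Q₁ Q : ℝ} (hM : 1 ≤ M) (hU : 1 ≤ U) (hQ₁ : 1 ≤ Q₁) (hQ : Q₁ ≤ Q)
    (Bl : Finset (Ideal (𝓞 K))) (hBl : ∀ 𝔟 ∈ Bl, 𝔟 ≠ ⊥ ∧ U < (Ideal.absNorm 𝔟 : ℝ) ∧ (Ideal.absNorm 𝔟 : ℝ) ≤ M ^ d / U)
    {𝔟₀ : Ideal (𝓞 K)} (h𝔟₀ : 𝔟₀ ∈ Bl) {j : ℕ} (hsame : ∀ 𝔟 ∈ Bl, nclass 𝔟 = nclass 𝔟₀ ∧ dyad 𝔟 = j) :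
    ∑ 𝔮 ∈ (idealsLE K Q).filter (fun 𝔮 => Q₁ < Ideal.absNorm 𝔮),
        (∑ χ ∈ primChars K 𝔮, ‖S4block K χ k M U Bl (cubeF K M)‖) / Nat.card ((𝓞 K ⧸ 𝔮)ˣ) ≤
      2 * Cblk K * Real.sqrt (Cidl K * (2 * Cbal K ^ (d * d))) * (∫ τ, ‖𝓕 k τ‖) ^ d *
        Real.log ((2 : ℝ) ^ (j + 1)) *
        Real.sqrt ((1 + Real.log (2 * Cbal K ^ (d * d) * M ^ d) / d) ^ rk * harmU K U ^ 3) *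
        (4 * Q * Real.sqrt (M ^ d) +
          (2 * Real.log Q + 1) * (Real.sqrt (2 * Cbal K ^ d) + Real.sqrt (2 * Cbal K ^ (d * d))) * (M ^ d / Real.sqrt U) +
          2 * Real.sqrt (Cbal K ^ d * (2 * Cbal K ^ (d * d))) * (M ^ d / Q₁)) := by
  obtain ⟨hC₀, hblock⟩ := Cblk_spec (K := K)
  obtain ⟨hCb1, hCbgen⟩ := Cbal_spec (K := K)
  obtain ⟨hCI, hCIle⟩ := Cidl_spec (K := K)
  -- name the constants
  obtain ⟨C₀, hC₀def⟩ : ∃ C₀ : ℝ, C₀ = Cblk K := ⟨_, rfl⟩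
  obtain ⟨Cb, hCbdef⟩ : ∃ Cb : ℝ, Cb = Cbal K := ⟨_, rfl⟩
  obtain ⟨CI, hCIdef⟩ : ∃ CI : ℝ, CI = Cidl K := ⟨_, rfl⟩
  rw [← hC₀def] at hC₀ hblock
  rw [← hCbdef] at hCb1 hCbgen
  rw [← hCIdef] at hCI hCIle
  rw [← hC₀def, ← hCbdef, ← hCIdef]
  have hd : 0 < d := Module.finrank_pos
  have hdR : (0 : ℝ) < d := by exact_mod_cast hd
  have hCb0 : 0 < Cb := by linarith
  obtain ⟨a, ha⟩ : ∃ a : ℝ, a = Cb ^ d := ⟨_, rfl⟩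
  obtain ⟨b, hb⟩ : ∃ b : ℝ, b = 2 * Cb ^ (d * d) := ⟨_, rfl⟩
  have ha0 : 0 < a := by rw [ha]; exact pow_pos hCb0 _
  have hb1 : 1 ≤ b := by
    rw [hb]; have := one_le_pow₀ (n := d * d) hCb1; linarith
  have hb0 : 0 < b := by linarith
  rw [← ha, ← hb]
  have hM0 : 0 < M := by linarith
  have hU0 : 0 < U := by linarith
  have hQ₁0 : 0 < Q₁ := by linarith
  have hQ1 : 1 ≤ Q := hQ₁.trans hQ
  have hQ0 : 0 < Q := by linarith
  obtain ⟨Kk, hKk⟩ : ∃ Kk : ℝ, Kk = (∫ τ, ‖𝓕 k τ‖) ^ d := ⟨_, rfl⟩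
  have hKk0 : 0 ≤ Kk := by rw [hKk]; exact pow_nonneg (integral_nonneg fun _ => norm_nonneg _) _
  obtain ⟨Md, hMd⟩ : ∃ Md : ℝ, Md = M ^ d := ⟨_, rfl⟩
  have hMd1 : 1 ≤ Md := by rw [hMd]; exact one_le_pow₀ hM
  have hMd0 : 0 < Md := by linarith
  obtain ⟨H3, hH3⟩ : ∃ H3 : ℝ, H3 = harmU K U ^ 3 := ⟨_, rfl⟩
  have hH30 : 0 ≤ H3 := by rw [hH3]; exact pow_nonneg (harmU_nonneg (K := K) U) 3
  rw [← hKk, ← hMd, ← hH3]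
  -- the block data
  obtain ⟨h𝔟₀0, hU𝔟₀, h𝔟₀M⟩ := hBl 𝔟₀ h𝔟₀
  have hj : dyad 𝔟₀ = j := (hsame 𝔟₀ h𝔟₀).2
  obtain ⟨hj1, hj2⟩ := dyad_spec h𝔟₀0
  rw [hj] at hj1 hj2
  obtain ⟨M', hM'⟩ : ∃ M' : ℝ, M' = (2 : ℝ) ^ (j + 1) := ⟨_, rfl⟩
  rw [← hM']
  have hM'1 : 1 ≤ M' := by rw [hM']; exact one_le_pow₀ (by norm_num)
  have hM'0 : 0 < M' := by linarith
  have hM'half : M' / 2 = 2 ^ j := by rw [hM', pow_succ]; ring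
  have hUM' : U < M' := by rw [hM']; linarith
  have hM'U : M' ≤ 2 * Md / U := by
    rw [le_div_iff₀ hU0, hM', pow_succ]
    have h1 : (2 : ℝ) ^ j * U ≤ Ideal.absNorm 𝔟₀ * U := mul_le_mul_of_nonneg_right hj1 hU0.le
    have h2 : (Ideal.absNorm 𝔟₀ : ℝ) * U ≤ Md := by rwa [le_div_iff₀ hU0, ← hMd] at h𝔟₀M
    nlinarith
  have hM'le : M' ≤ 2 * M ^ d := by
    rw [← hMd]; refine hM'U.trans ?_
    rw [div_le_iff₀ hU0]; nlinarith
  obtain ⟨v₁, v₂, ρ₀, gen, hQv₁, hQv₂, hρspan, hρpos, hρbal, hgen⟩ := exists_classData hCbgen h𝔟₀0 (2 * Q)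
  have hBl' : ∀ 𝔟 ∈ Bl, 𝔟 ≠ ⊥ ∧ M' / 2 ≤ Ideal.absNorm 𝔟 ∧ (Ideal.absNorm 𝔟 : ℝ) ≤ M' := by
    intro 𝔟 h𝔟
    obtain ⟨h0, -, -⟩ := hBl 𝔟 h𝔟
    obtain ⟨-, hdy⟩ := hsame 𝔟 h𝔟
    obtain ⟨h1, h2⟩ := dyad_spec h0
    rw [hdy] at h1 h2
    exact ⟨h0, by rwa [hM'half], by rw [hM']; exact h2.le⟩
  have hgen' : ∀ 𝔟 ∈ Bl, NumberField.IsTotPos K (gen 𝔟 : K) ∧ Ideal.span {gen 𝔟} = v₁.asIdeal * 𝔟 ∧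
      ∀ w : RP, remb K (gen 𝔟 : K) w ≤ Cb * (Ideal.absNorm (Ideal.span {gen 𝔟}) : ℝ) ^ ((d : ℝ)⁻¹) :=
    fun 𝔟 h𝔟 => hgen 𝔟 (hBl 𝔟 h𝔟).1 (hsame 𝔟 h𝔟).1
  -- the atoms of the block bound
  obtain ⟨B₁, hB₁⟩ : ∃ B₁ : ℝ, B₁ = Real.log M' ^ 2 * Bl.card := ⟨_, rfl⟩
  obtain ⟨L, hL⟩ : ∃ L : ℝ, L = (1 + Real.log (b * Md) / d) ^ rk := ⟨_, rfl⟩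
  rw [← hL]
  obtain ⟨Y, hY⟩ : ∃ Y : ℝ, Y = b * Md / M' := ⟨_, rfl⟩
  have hY0 : 0 ≤ Y := by rw [hY]; positivity
  have hlogM' : 0 ≤ Real.log M' := Real.log_nonneg hM'1
  have hB₁0 : 0 ≤ B₁ := by rw [hB₁]; positivity
  have hbase1 : 1 ≤ 1 + Real.log (b * Md) / d := by
    have : 0 ≤ Real.log (b * Md) := Real.log_nonneg (by nlinarith)
    have := div_nonneg this hdR.le; linarith
  have hL0 : 0 ≤ L := by rw [hL]; exact le_trans zero_le_one (one_le_pow₀ hbase1)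
  obtain ⟨G, hG⟩ : ∃ G : ℝ, G = C₀ * Kk * Real.sqrt (B₁ * (L * Y * H3)) := ⟨_, rfl⟩
  have hG0 : 0 ≤ G := by rw [hG]; have := hC₀.le; positivity
  obtain ⟨X, hX⟩ : ∃ X : Ideal (𝓞 K) → ℝ, X = fun 𝔮 => ∑ χ ∈ primChars K 𝔮, ‖S4block K χ k M U Bl (cubeF K M)‖ :=
    ⟨_, rfl⟩
  have hX0 : ∀ 𝔮, 0 ≤ X 𝔮 := fun 𝔮 => by rw [hX]; exact Finset.sum_nonneg fun _ _ => norm_nonneg _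
  -- the level-`P` bound
  have hF : ∀ P : ℝ, 1 ≤ P → P ≤ 2 * Q →
      ∑ 𝔮 ∈ idealsLE K P, (Ideal.absNorm 𝔮 : ℝ) / Nat.card ((𝓞 K ⧸ 𝔮)ˣ) * X 𝔮 ≤
        G * ((P + Real.sqrt (a * M')) * (P + Real.sqrt Y)) := by
    intro P hP hP2
    have hP0 : 0 ≤ P := by linarith
    have hb' := hblock k hk hks hk0 M hM U P hP Cb hCb1 M' hM'1 hM'le v₁.asIdeal v₂.asIdeal ρ₀ v₁.ne_bot v₂.ne_bot
      hρspan hρpos hρbal Bl gen hBl' hgen'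
    have hfilter : (idealsLE K P).filter (fun 𝔮 => IsCoprime 𝔮 v₁.asIdeal ∧ IsCoprime 𝔮 v₂.asIdeal) = idealsLE K P := by
      refine Finset.filter_true_of_mem fun 𝔮 h𝔮 => ?_
      rw [mem_idealsLE] at h𝔮
      exact ⟨isCoprime_of_absNorm_lt v₁ h𝔮.1 (by linarith [h𝔮.2]),
        isCoprime_of_absNorm_lt v₂ h𝔮.1 (by linarith [h𝔮.2])⟩
    rw [hfilter, ← hKk, ← hB₁, ← hb, ← ha, ← hMd, ← hL, ← hY, ← hH3] at hb'
    have hXq : ∀ 𝔮, (Ideal.absNorm 𝔮 : ℝ) / Nat.card ((𝓞 K ⧸ 𝔮)ˣ) * X 𝔮 =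
        (Ideal.absNorm 𝔮 : ℝ) / Nat.card ((𝓞 K ⧸ 𝔮)ˣ) * ∑ χ ∈ primChars K 𝔮, ‖S4block K χ k M U Bl (cubeF K M)‖ := by
      intro 𝔮; rw [hX]
    rw [Finset.sum_congr rfl fun 𝔮 _ => hXq 𝔮]
    refine hb'.trans ?_
    have h1 : Real.sqrt ((P ^ 2 + a * M') * B₁) ≤ (P + Real.sqrt (a * M')) * Real.sqrt B₁ :=
      sqrt_sq_add_mul_le hP0 (by positivity)
    have h2 : Real.sqrt ((P ^ 2 + Y) * (L * Y * H3)) ≤ (P + Real.sqrt Y) * Real.sqrt (L * Y * H3) :=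
      sqrt_sq_add_mul_le hP0 hY0
    rw [hG]
    have hC₀Kk : 0 ≤ C₀ * Kk := mul_nonneg hC₀.le hKk0
    calc C₀ * Kk * (Real.sqrt ((P ^ 2 + a * M') * B₁) * Real.sqrt ((P ^ 2 + Y) * (L * Y * H3)))
        ≤ C₀ * Kk * (((P + Real.sqrt (a * M')) * Real.sqrt B₁) * ((P + Real.sqrt Y) * Real.sqrt (L * Y * H3))) :=
          mul_le_mul_of_nonneg_left (mul_le_mul h1 h2 (Real.sqrt_nonneg _) (by positivity)) hC₀Kk
      _ = C₀ * Kk * (Real.sqrt B₁ * Real.sqrt (L * Y * H3)) * ((P + Real.sqrt (a * M')) * (P + Real.sqrt Y)) := by ring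
      _ = _ := by rw [← Real.sqrt_mul hB₁0]
  have hdy := dyadic_moduli hX0 hQ₁ hQ hG0 (Real.sqrt_nonneg _) (Real.sqrt_nonneg _) hF
  have hLHS : ∑ 𝔮 ∈ (idealsLE K Q).filter (fun 𝔮 => Q₁ < Ideal.absNorm 𝔮),
      (∑ χ ∈ primChars K 𝔮, ‖S4block K χ k M U Bl (cubeF K M)‖) / Nat.card ((𝓞 K ⧸ 𝔮)ˣ) =
      ∑ 𝔮 ∈ (idealsLE K Q).filter (fun 𝔮 => Q₁ < Ideal.absNorm 𝔮), X 𝔮 / Nat.card ((𝓞 K ⧸ 𝔮)ˣ) := by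
    rw [hX]
  rw [hLHS]
  refine hdy.trans ?_
  -- the bookkeeping
  have hcard : (Bl.card : ℝ) ≤ CI * M' := by
    have hsub : Bl ⊆ idealsLE K M' := fun 𝔟 h𝔟 => by
      rw [mem_idealsLE]; exact ⟨(hBl' 𝔟 h𝔟).1, (hBl' 𝔟 h𝔟).2.2⟩
    exact (Nat.cast_le.2 (Finset.card_le_card hsub)).trans (hCIle M' hM'0.le)
  have hB₁le : B₁ ≤ Real.log M' ^ 2 * (CI * M') := by
    rw [hB₁]; exact mul_le_mul_of_nonneg_left hcard (by positivity)
  have hMY : M' * Y = b * Md := by rw [hY]; field_simp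
  have hYU : Y ≤ b * Md / U := by
    rw [hY]
    exact div_le_div_of_nonneg_left (by positivity) hU0 hUM'.le
  have hlogQ : 0 ≤ Real.log Q := Real.log_nonneg hQ1
  have halg := block_algebra (NI := 2 * Real.log Q + 1) hC₀.le hKk0 hCI.le ha0.le hb0.le hL0 hH30 hMd0.le hU0
    hQ0.le hQ₁0 (by linarith) hM'0.le hY0 hlogM' hB₁le hMY hYU hM'U
  rw [hG]
  refine halg.trans (le_of_eq ?_)
  rw [hM']

set_option maxHeartbeats 800000 in
-- the polishing of the raw bound carries a dozen real atoms
/-- **The type II bound for one narrow class and one dyadic range of `N𝔟`** (uniformly in the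
class and the range): for a block `Bl` of ideals in one narrow class with one dyadic index and
`U < N𝔟 ≤ M^d/U`,
`∑_{Q₁<N𝔮≤Q} (1/φ(𝔮)) ∑*_χ |S₄-block(χ)| ≤ C ‖k̂‖₁^d (1+log M)^{d-1} √(H(U)³) log(2M^d) (Q M^{d/2} + (2 log Q + 1) M^d/√U + M^d/Q₁)`.
[cite: Hinz1988, §4 (4.20)] -/
theorem classBlock_bound : ∃ C : ℝ, 0 < C ∧
    ∀ (k : ℝ → ℂ), ContDiff ℝ 2 k → HasCompactSupport k → (∀ v, 0 < v → k v = 0) →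
    ∀ (M U Q₁ Q : ℝ), 1 ≤ M → 1 ≤ U → 1 ≤ Q₁ → Q₁ ≤ Q →
    ∀ (Bl : Finset (Ideal (𝓞 K))),
      (∀ 𝔟 ∈ Bl, 𝔟 ≠ ⊥ ∧ U < (Ideal.absNorm 𝔟 : ℝ) ∧ (Ideal.absNorm 𝔟 : ℝ) ≤ M ^ d / U) →
      (∀ 𝔟 ∈ Bl, ∀ 𝔟' ∈ Bl, nclass 𝔟 = nclass 𝔟' ∧ dyad 𝔟 = dyad 𝔟') →
    ∑ 𝔮 ∈ (idealsLE K Q).filter (fun 𝔮 => Q₁ < Ideal.absNorm 𝔮),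
        (∑ χ ∈ primChars K 𝔮, ‖S4block K χ k M U Bl (cubeF K M)‖) / Nat.card ((𝓞 K ⧸ 𝔮)ˣ) ≤
      C * (∫ τ, ‖𝓕 k τ‖) ^ d * (1 + Real.log M) ^ rk * Real.sqrt (harmU K U ^ 3) * Real.log (2 * M ^ d) *
        (Q * Real.sqrt (M ^ d) + (2 * Real.log Q + 1) * (M ^ d / Real.sqrt U) + M ^ d / Q₁) := by
  obtain ⟨hC₀, -⟩ := Cblk_spec (K := K)
  obtain ⟨hCb1, -⟩ := Cbal_spec (K := K)
  obtain ⟨hCI, -⟩ := Cidl_spec (K := K)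
  obtain ⟨C₀, hC₀def⟩ : ∃ C₀ : ℝ, C₀ = Cblk K := ⟨_, rfl⟩
  obtain ⟨Cb, hCbdef⟩ : ∃ Cb : ℝ, Cb = Cbal K := ⟨_, rfl⟩
  obtain ⟨CI, hCIdef⟩ : ∃ CI : ℝ, CI = Cidl K := ⟨_, rfl⟩
  rw [← hC₀def] at hC₀
  rw [← hCbdef] at hCb1
  rw [← hCIdef] at hCI
  have hd : 0 < d := Module.finrank_pos
  have hdR : (0 : ℝ) < d := by exact_mod_cast hd
  have hCb0 : 0 < Cb := by linarith
  obtain ⟨a, ha⟩ : ∃ a : ℝ, a = Cb ^ d := ⟨_, rfl⟩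
  obtain ⟨b, hb⟩ : ∃ b : ℝ, b = 2 * Cb ^ (d * d) := ⟨_, rfl⟩
  have ha0 : 0 < a := by rw [ha]; exact pow_pos hCb0 _
  have hb1 : 1 ≤ b := by
    rw [hb]; have := one_le_pow₀ (n := d * d) hCb1; linarith
  have hb0 : 0 < b := by linarith
  obtain ⟨C₂, hC₂⟩ : ∃ C₂ : ℝ, C₂ = 1 + Real.log b / d := ⟨_, rfl⟩
  have hC₂1 : 1 ≤ C₂ := by
    rw [hC₂]; have := Real.log_nonneg hb1; have := div_nonneg this hdR.le; linarith
  obtain ⟨c, hc⟩ : ∃ c : ℝ, c = 4 + (Real.sqrt (2 * a) + Real.sqrt b) + 2 * Real.sqrt (a * b) := ⟨_, rfl⟩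
  have hc0 : 0 ≤ c := by rw [hc]; positivity
  obtain ⟨V, hV⟩ : ∃ V : ℝ, V = Real.sqrt (CI * b) := ⟨_, rfl⟩
  have hV0 : 0 ≤ V := by rw [hV]; exact Real.sqrt_nonneg _
  refine ⟨2 * C₀ * V * C₂ ^ rk * c + 1, by positivity, ?_⟩
  intro k hk hks hk0 M U Q₁ Q hM hU hQ₁ hQ Bl hBl hsame
  have hM0 : 0 < M := by linarith
  have hU0 : 0 < U := by linarith
  have hQ₁0 : 0 < Q₁ := by linarith
  have hQ1 : 1 ≤ Q := hQ₁.trans hQ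
  have hQ0 : 0 < Q := by linarith
  obtain ⟨Kk, hKk⟩ : ∃ Kk : ℝ, Kk = (∫ τ, ‖𝓕 k τ‖) ^ d := ⟨_, rfl⟩
  have hKk0 : 0 ≤ Kk := by rw [hKk]; exact pow_nonneg (integral_nonneg fun _ => norm_nonneg _) _
  obtain ⟨Md, hMd⟩ : ∃ Md : ℝ, Md = M ^ d := ⟨_, rfl⟩
  have hMd1 : 1 ≤ Md := by rw [hMd]; exact one_le_pow₀ hM
  have hMd0 : 0 < Md := by linarith
  obtain ⟨H3, hH3⟩ : ∃ H3 : ℝ, H3 = harmU K U ^ 3 := ⟨_, rfl⟩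
  have hH30 : 0 ≤ H3 := by rw [hH3]; exact pow_nonneg (harmU_nonneg (K := K) U) 3
  rw [← hKk, ← hMd, ← hH3]
  have hlogM : 0 ≤ Real.log M := Real.log_nonneg hM
  have hlog2Md : 0 ≤ Real.log (2 * Md) := Real.log_nonneg (by linarith)
  have hlogQ : 0 ≤ Real.log Q := Real.log_nonneg hQ1
  obtain ⟨br', hbrd'⟩ : ∃ br' : ℝ, br' = Q * Real.sqrt Md + (2 * Real.log Q + 1) * (Md / Real.sqrt U) + Md / Q₁ := ⟨_, rfl⟩
  have hbr0 : 0 ≤ br' := by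
    rw [hbrd']
    have : 0 ≤ (2 * Real.log Q + 1) * (Md / Real.sqrt U) := mul_nonneg (by linarith) (by positivity)
    positivity
  rw [← hbrd']
  have hC0' : 0 ≤ 2 * C₀ * V * C₂ ^ rk * c + 1 := by positivity
  have hRHS0 : 0 ≤ (2 * C₀ * V * C₂ ^ rk * c + 1) * Kk * (1 + Real.log M) ^ rk * Real.sqrt H3 * Real.log (2 * Md) * br' :=
    mul_nonneg (mul_nonneg (mul_nonneg (mul_nonneg (mul_nonneg hC0' hKk0) (pow_nonneg (by linarith) _))
      (Real.sqrt_nonneg _)) hlog2Md) hbr0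
  -- the empty block
  rcases Finset.eq_empty_or_nonempty Bl with hemp | ⟨𝔟₀, h𝔟₀⟩
  · rw [hemp]
    refine le_trans (le_of_eq ?_) hRHS0
    refine Finset.sum_eq_zero fun 𝔮 _ => ?_
    rw [Finset.sum_eq_zero fun χ _ => by rw [S4block_empty, norm_zero], zero_div]
  -- the raw bound
  obtain ⟨j, hj⟩ : ∃ j : ℕ, j = dyad 𝔟₀ := ⟨_, rfl⟩
  have hsame' : ∀ 𝔟 ∈ Bl, nclass 𝔟 = nclass 𝔟₀ ∧ dyad 𝔟 = j := fun 𝔟 h => hj ▸ hsame 𝔟 h 𝔟₀ h𝔟₀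
  have hraw := classBlock_raw k hk hks hk0 hM hU hQ₁ hQ Bl hBl h𝔟₀ hsame'
  rw [← hC₀def, ← hCbdef, ← hCIdef, ← ha, ← hb, ← hKk, ← hMd, ← hH3, ← hV] at hraw
  refine hraw.trans ?_
  -- `log 2^{j+1} ≤ log (2 Md)`: `2^j ≤ N𝔟₀ ≤ Md/U ≤ Md`
  obtain ⟨h𝔟₀0, hU𝔟₀, h𝔟₀M⟩ := hBl 𝔟₀ h𝔟₀
  obtain ⟨hj1, -⟩ := dyad_spec h𝔟₀0
  rw [← hj] at hj1
  have hM'le : (2 : ℝ) ^ (j + 1) ≤ 2 * Md := by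
    rw [pow_succ]
    have : (Ideal.absNorm 𝔟₀ : ℝ) ≤ Md := by
      rw [← hMd] at h𝔟₀M
      exact h𝔟₀M.trans (div_le_self hMd0.le hU)
    linarith
  have hlM : Real.log ((2 : ℝ) ^ (j + 1)) ≤ Real.log (2 * Md) := Real.log_le_log (by positivity) hM'le
  have hlM0 : 0 ≤ Real.log ((2 : ℝ) ^ (j + 1)) := Real.log_nonneg (one_le_pow₀ (by norm_num))
  -- `√(L H3) ≤ C₂^{rk} (1 + log M)^{rk} √H3`
  obtain ⟨L, hL⟩ : ∃ L : ℝ, L = (1 + Real.log (b * Md) / d) ^ rk := ⟨_, rfl⟩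
  rw [← hL]
  have hsplit : Real.log (b * Md) / d = Real.log b / d + Real.log M := by
    rw [hMd, Real.log_mul hb0.ne' (by positivity), Real.log_pow, add_div, mul_div_cancel_left₀ _ hdR.ne']
  have hkey : 1 + Real.log (b * Md) / d = C₂ + Real.log M := by rw [hsplit, hC₂]; ring
  have hL1 : 1 ≤ L := by rw [hL, hkey]; exact one_le_pow₀ (by linarith)
  have hL0 : 0 ≤ L := by linarith
  have hLle : L ≤ C₂ ^ rk * (1 + Real.log M) ^ rk := by
    rw [hL, ← mul_pow, hkey]
    exact pow_le_pow_left₀ (by linarith) (by nlinarith) _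
  have hsq : Real.sqrt (L * H3) ≤ C₂ ^ rk * (1 + Real.log M) ^ rk * Real.sqrt H3 := by
    rw [Real.sqrt_mul hL0]
    refine mul_le_mul_of_nonneg_right ?_ (Real.sqrt_nonneg _)
    refine le_trans ?_ hLle
    rw [Real.sqrt_le_left hL0]; nlinarith
  -- the brackets
  have hbr : 4 * Q * Real.sqrt Md + (2 * Real.log Q + 1) * (Real.sqrt (2 * a) + Real.sqrt b) * (Md / Real.sqrt U) +
      2 * Real.sqrt (a * b) * (Md / Q₁) ≤ c * br' := by
    have h1 : 0 ≤ Q * Real.sqrt Md := by positivity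
    have h2 : 0 ≤ (2 * Real.log Q + 1) * (Md / Real.sqrt U) := mul_nonneg (by linarith) (by positivity)
    have h3 : 0 ≤ Md / Q₁ := by positivity
    have hs1 := Real.sqrt_nonneg (2 * a)
    have hs2 := Real.sqrt_nonneg b
    have hs3 := Real.sqrt_nonneg (a * b)
    have hc1 : Real.sqrt (2 * a) + Real.sqrt b ≤ c := by rw [hc]; linarith
    have hc2 : 2 * Real.sqrt (a * b) ≤ c := by rw [hc]; linarith
    have hc4 : 4 ≤ c := by rw [hc]; linarith
    rw [hbrd']
    calc 4 * Q * Real.sqrt Md + (2 * Real.log Q + 1) * (Real.sqrt (2 * a) + Real.sqrt b) * (Md / Real.sqrt U) +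
          2 * Real.sqrt (a * b) * (Md / Q₁)
        = 4 * (Q * Real.sqrt Md) + (Real.sqrt (2 * a) + Real.sqrt b) * ((2 * Real.log Q + 1) * (Md / Real.sqrt U)) +
            2 * Real.sqrt (a * b) * (Md / Q₁) := by ring
      _ ≤ c * (Q * Real.sqrt Md) + c * ((2 * Real.log Q + 1) * (Md / Real.sqrt U)) + c * (Md / Q₁) :=
          add_le_add (add_le_add (mul_le_mul_of_nonneg_right hc4 h1) (mul_le_mul_of_nonneg_right hc1 h2))
            (mul_le_mul_of_nonneg_right hc2 h3)
      _ = _ := by ring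
  -- fold and finish
  obtain ⟨lM', hlM'⟩ : ∃ lM' : ℝ, lM' = Real.log ((2 : ℝ) ^ (j + 1)) := ⟨_, rfl⟩
  obtain ⟨l2, hl2⟩ : ∃ l2 : ℝ, l2 = Real.log (2 * Md) := ⟨_, rfl⟩
  obtain ⟨R, hR⟩ : ∃ R : ℝ, R = Real.sqrt (L * H3) := ⟨_, rfl⟩
  obtain ⟨R', hR'⟩ : ∃ R' : ℝ, R' = C₂ ^ rk * (1 + Real.log M) ^ rk * Real.sqrt H3 := ⟨_, rfl⟩
  obtain ⟨br, hbrd⟩ : ∃ br : ℝ, br = 4 * Q * Real.sqrt Md + (2 * Real.log Q + 1) * (Real.sqrt (2 * a) + Real.sqrt b) *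
    (Md / Real.sqrt U) + 2 * Real.sqrt (a * b) * (Md / Q₁) := ⟨_, rfl⟩
  rw [← hlM', ← hR, ← hbrd, ← hl2]
  rw [← hlM', ← hl2] at hlM
  rw [← hlM'] at hlM0
  rw [← hR, ← hR'] at hsq
  rw [← hbrd] at hbr
  have hR0 : 0 ≤ R := by rw [hR]; exact Real.sqrt_nonneg _
  have hRR' : 0 ≤ R' := hR0.trans hsq
  have hA : 0 ≤ 2 * C₀ * V * Kk := by have := hC₀.le; positivity
  have hl20 : 0 ≤ l2 := by rw [hl2]; exact hlog2Md
  calc 2 * C₀ * V * Kk * lM' * R * br ≤ 2 * C₀ * V * Kk * (l2 * R' * (c * br')) := by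
        have h1 : lM' * R * br ≤ l2 * R' * (c * br') :=
          mul_le_mul (mul_le_mul hlM hsq hR0 (hlM0.trans hlM)) hbr (by rw [hbrd]; positivity)
            (mul_nonneg (hlM0.trans hlM) hRR')
        calc 2 * C₀ * V * Kk * lM' * R * br = (2 * C₀ * V * Kk) * (lM' * R * br) := by ring
          _ ≤ (2 * C₀ * V * Kk) * (l2 * R' * (c * br')) := mul_le_mul_of_nonneg_left h1 hA
    _ = (2 * C₀ * V * C₂ ^ rk * c) * (Kk * (1 + Real.log M) ^ rk * Real.sqrt H3 * l2 * br') := by rw [hR']; ring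
    _ ≤ (2 * C₀ * V * C₂ ^ rk * c + 1) * (Kk * (1 + Real.log M) ^ rk * Real.sqrt H3 * l2 * br') :=
        mul_le_mul_of_nonneg_right (by linarith) (by positivity)
    _ = _ := by ring

/-! ## The total type II sum -/

variable (K) in
/-- **The type II sum** `S₄(χ) = ∑_{U < N𝔟 ≤ M^d} Λ(𝔟) ∑_{α ∈ A₀(M), 𝔟 ∣ (α) ≠ 𝔟} Ω(α) χ(α) e_U((α)/𝔟)`
(the fourth term of Vaughan's identity for the smooth cube sum). [cite: Hinz1988, §4 (4.10)] -/
def S4total {𝔮 : Ideal (𝓞 K)} (χ : AddChar (Additive ((𝓞 K ⧸ 𝔮)ˣ)) ℂ) (k : ℝ → ℂ) (M U : ℝ) : ℂ :=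
  S4block K χ k M U ((idealsLE K (M ^ d)).filter fun 𝔟 => U < (Ideal.absNorm 𝔟 : ℝ)) (cubeF K M)

/-- The index set of the blocks: narrow classes × dyadic indices `< J`. [folklore] -/
theorem norm_S4total_le_sum {𝔮 : Ideal (𝓞 K)} (χ : AddChar (Additive ((𝓞 K ⧸ 𝔮)ˣ)) ℂ) (k : ℝ → ℂ)
    {M U : ℝ} (hU : 0 < U) (T : Finset (NCl K × ℕ))
    (hT : ∀ 𝔟 ∈ ((idealsLE K (M ^ d)).filter fun 𝔟 => U < (Ideal.absNorm 𝔟 : ℝ)).filter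
      (fun 𝔟 => (Ideal.absNorm 𝔟 : ℝ) ≤ M ^ d / U), (nclass 𝔟, dyad 𝔟) ∈ T) :
    ‖S4total K χ k M U‖ ≤ ∑ t ∈ T, ‖S4block K χ k M U
      ((((idealsLE K (M ^ d)).filter fun 𝔟 => U < (Ideal.absNorm 𝔟 : ℝ)).filter
        (fun 𝔟 => (Ideal.absNorm 𝔟 : ℝ) ≤ M ^ d / U)).filter fun 𝔟 => (nclass 𝔟, dyad 𝔟) = t) (cubeF K M)‖ := by
  unfold S4total
  have h1 := S4block_filter_large χ k (M := M) hU ((idealsLE K (M ^ d)).filter fun 𝔟 => U < (Ideal.absNorm 𝔟 : ℝ))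
    (fun 𝔟 h𝔟 => (mem_idealsLE.1 (Finset.mem_filter.1 h𝔟).1).1)
  have h2 := S4block_sum_fiberwise χ k M U _ (cubeF K M) T (fun 𝔟 => (nclass 𝔟, dyad 𝔟)) hT
  rw [h1, h2]
  convert norm_sum_le (E := ℂ) T _ using 0

set_option maxHeartbeats 400000 in
-- the final assembly sums the uniform block bound over classes and dyadic ranges
/-- **Hinz's type II estimate (4.20), smooth form.** For `3 ≤ M`, `1 ≤ U`, `1 ≤ Q₁ ≤ Q ≤ M^d` and a
`C²` compactly supported profile `k` vanishing on `(0, ∞)`: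
`∑_{Q₁<N𝔮≤Q} (1/φ(𝔮)) ∑*_χ |S₄(χ)| ≤ C ‖k̂‖₁^d (log M)^{r+3} √(H(U)³) (Q M^{d/2} + M^d/√U + M^d/Q₁)`
(`r = d - 1` the unit rank, `H(U) = ∑_{N𝔡≤U} 1/N𝔡`). [cite: Hinz1988, §4 (4.20)] -/
theorem typeII_bound : ∃ C : ℝ, 0 < C ∧
    ∀ (k : ℝ → ℂ), ContDiff ℝ 2 k → HasCompactSupport k → (∀ v, 0 < v → k v = 0) →
    ∀ (M U Q₁ Q : ℝ), 3 ≤ M → 1 ≤ U → 1 ≤ Q₁ → Q₁ ≤ Q → Q ≤ M ^ d →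
    ∑ 𝔮 ∈ (idealsLE K Q).filter (fun 𝔮 => Q₁ < Ideal.absNorm 𝔮),
        (∑ χ ∈ primChars K 𝔮, ‖S4total K χ k M U‖) / Nat.card ((𝓞 K ⧸ 𝔮)ˣ) ≤
      C * (∫ τ, ‖𝓕 k τ‖) ^ d * Real.log M ^ (rk + 3) * Real.sqrt (harmU K U ^ 3) *
        (Q * Real.sqrt (M ^ d) + M ^ d / Real.sqrt U + M ^ d / Q₁) := by
  obtain ⟨C₁, hC₁, hB⟩ := classBlock_bound (K := K)
  haveI : Fintype (NCl K) := Fintype.ofFinite _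
  have hd : 0 < d := Module.finrank_pos
  have hdR : (0 : ℝ) < d := by exact_mod_cast hd
  obtain ⟨h, hh⟩ : ∃ h : ℕ, h = Fintype.card (NCl K) := ⟨_, rfl⟩
  -- the constant
  refine ⟨C₁ * h * (2 * d + 1) * 2 ^ rk * (d + 1) * (2 * d + 1) + 1, by positivity, ?_⟩
  intro k hk hks hk0 M U Q₁ Q hM hU hQ₁ hQ hQM
  have hM1 : 1 ≤ M := by linarith
  have hM0 : 0 < M := by linarith
  have hU0 : 0 < U := by linarith
  have hQ₁0 : 0 < Q₁ := by linarith
  have hQ1 : 1 ≤ Q := hQ₁.trans hQ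
  have hlogM1 : 1 ≤ Real.log M := by
    rw [Real.le_log_iff_exp_le hM0]
    have := Real.exp_one_lt_d9; norm_num at this; linarith
  have hlogM0 : 0 ≤ Real.log M := by linarith
  obtain ⟨Kk, hKk⟩ : ∃ Kk : ℝ, Kk = (∫ τ, ‖𝓕 k τ‖) ^ d := ⟨_, rfl⟩
  have hKk0 : 0 ≤ Kk := by rw [hKk]; exact pow_nonneg (integral_nonneg fun _ => norm_nonneg _) _
  obtain ⟨Md, hMd⟩ : ∃ Md : ℝ, Md = M ^ d := ⟨_, rfl⟩
  have hMd1 : 1 ≤ Md := by rw [hMd]; exact one_le_pow₀ hM1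
  have hMd0 : 0 < Md := by linarith
  obtain ⟨sH, hsH⟩ : ∃ sH : ℝ, sH = Real.sqrt (harmU K U ^ 3) := ⟨_, rfl⟩
  have hsH0 : 0 ≤ sH := by rw [hsH]; exact Real.sqrt_nonneg _
  rw [← hKk, ← hsH]
  -- the index set
  obtain ⟨J, hJ⟩ : ∃ J : ℕ, J = Nat.log 2 ⌊Md⌋₊ + 1 := ⟨_, rfl⟩
  obtain ⟨T, hTdef⟩ : ∃ T : Finset (NCl K × ℕ), T = Finset.univ ×ˢ Finset.range J := ⟨_, rfl⟩
  obtain ⟨Bl', hBl'⟩ : ∃ Bl' : Finset (Ideal (𝓞 K)), Bl' = ((idealsLE K (M ^ d)).filter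
    fun 𝔟 => U < (Ideal.absNorm 𝔟 : ℝ)).filter (fun 𝔟 => (Ideal.absNorm 𝔟 : ℝ) ≤ M ^ d / U) := ⟨_, rfl⟩
  have hmemBl' : ∀ 𝔟 ∈ Bl', 𝔟 ≠ ⊥ ∧ U < (Ideal.absNorm 𝔟 : ℝ) ∧ (Ideal.absNorm 𝔟 : ℝ) ≤ M ^ d / U ∧
      (Ideal.absNorm 𝔟 : ℝ) ≤ M ^ d := by
    intro 𝔟 h𝔟
    rw [hBl', Finset.mem_filter, Finset.mem_filter, mem_idealsLE] at h𝔟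
    exact ⟨h𝔟.1.1.1, h𝔟.1.2, h𝔟.2, h𝔟.1.1.2⟩
  have hT : ∀ 𝔟 ∈ Bl', (nclass 𝔟, dyad 𝔟) ∈ T := by
    intro 𝔟 h𝔟
    obtain ⟨h0, -, -, hle⟩ := hmemBl' 𝔟 h𝔟
    rw [hTdef, Finset.mem_product, Finset.mem_range]
    refine ⟨Finset.mem_univ _, ?_⟩
    rw [hJ]
    change Nat.log 2 (Ideal.absNorm 𝔟) < Nat.log 2 ⌊Md⌋₊ + 1
    refine Nat.lt_succ_of_le (Nat.log_mono_right (Nat.le_floor ?_))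
    rw [hMd]; exact hle
  -- blockwise
  have hblk : ∀ t ∈ T, ∑ 𝔮 ∈ (idealsLE K Q).filter (fun 𝔮 => Q₁ < Ideal.absNorm 𝔮),
      (∑ χ ∈ primChars K 𝔮, ‖S4block K χ k M U (Bl'.filter fun 𝔟 => (nclass 𝔟, dyad 𝔟) = t) (cubeF K M)‖) /
        Nat.card ((𝓞 K ⧸ 𝔮)ˣ) ≤
      C₁ * Kk * (1 + Real.log M) ^ rk * sH * Real.log (2 * Md) *
        (Q * Real.sqrt Md + (2 * Real.log Q + 1) * (Md / Real.sqrt U) + Md / Q₁) := by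
    intro t _
    have := hB k hk hks hk0 M U Q₁ Q hM1 hU hQ₁ hQ (Bl'.filter fun 𝔟 => (nclass 𝔟, dyad 𝔟) = t)
      (fun 𝔟 h𝔟 => by
        obtain ⟨h0, h1, h2, -⟩ := hmemBl' 𝔟 (Finset.mem_filter.1 h𝔟).1
        exact ⟨h0, h1, h2⟩)
      (fun 𝔟 h𝔟 𝔟' h𝔟' => by
        have e := (Finset.mem_filter.1 h𝔟).2
        have e' := (Finset.mem_filter.1 h𝔟').2
        rw [← e'] at e
        simp only [Prod.mk.injEq] at e
        exact e)
    rwa [← hKk, ← hMd, ← hsH] at this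
  -- sum over the blocks
  have hstep1 : ∑ 𝔮 ∈ (idealsLE K Q).filter (fun 𝔮 => Q₁ < Ideal.absNorm 𝔮),
      (∑ χ ∈ primChars K 𝔮, ‖S4total K χ k M U‖) / Nat.card ((𝓞 K ⧸ 𝔮)ˣ) ≤
      ∑ t ∈ T, ∑ 𝔮 ∈ (idealsLE K Q).filter (fun 𝔮 => Q₁ < Ideal.absNorm 𝔮),
        (∑ χ ∈ primChars K 𝔮, ‖S4block K χ k M U (Bl'.filter fun 𝔟 => (nclass 𝔟, dyad 𝔟) = t) (cubeF K M)‖) /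
          Nat.card ((𝓞 K ⧸ 𝔮)ˣ) := by
    rw [Finset.sum_comm]
    refine Finset.sum_le_sum fun 𝔮 h𝔮 => ?_
    rw [← Finset.sum_div, Finset.sum_comm]
    refine div_le_div_of_nonneg_right (Finset.sum_le_sum fun χ _ => ?_) (Nat.cast_nonneg _)
    have := norm_S4total_le_sum χ k (M := M) hU0 T (by rw [← hBl']; exact hT)
    rwa [← hBl'] at this
  refine hstep1.trans ((Finset.sum_le_sum hblk).trans ?_)
  rw [← hMd]
  rw [Finset.sum_const, nsmul_eq_mul]
  have hcardT : (T.card : ℝ) = h * J := by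
    rw [hTdef, Finset.card_product, Finset.card_univ, Finset.card_range, hh]; push_cast; ring
  rw [hcardT]
  -- the logarithms
  have hJle : (J : ℝ) ≤ (2 * d + 1) * Real.log M := by
    rw [hJ]; push_cast
    have h1 := natLog_le_two_mul_log hMd1
    have h2 : Real.log Md = d * Real.log M := by rw [hMd, Real.log_pow]
    rw [h2] at h1
    nlinarith
  have hlog2Md : Real.log (2 * Md) ≤ (d + 1) * Real.log M := by
    rw [Real.log_mul two_ne_zero hMd0.ne', hMd, Real.log_pow]
    have : Real.log 2 ≤ Real.log M := Real.log_le_log two_pos (by linarith)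
    nlinarith
  have hlog2Md0 : 0 ≤ Real.log (2 * Md) := Real.log_nonneg (by linarith)
  have hpowle : (1 + Real.log M) ^ rk ≤ 2 ^ rk * Real.log M ^ rk := by
    rw [← mul_pow]; exact pow_le_pow_left₀ (by linarith) (by linarith) _
  have hlogQ : Real.log Q ≤ d * Real.log M := by
    have := Real.log_le_log (by linarith) hQM
    rwa [Real.log_pow] at this
  have hlogQ0 : 0 ≤ Real.log Q := Real.log_nonneg hQ1
  have hbr : Q * Real.sqrt Md + (2 * Real.log Q + 1) * (Md / Real.sqrt U) + Md / Q₁ ≤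
      (2 * d + 1) * Real.log M * (Q * Real.sqrt Md + Md / Real.sqrt U + Md / Q₁) := by
    have h1 : 0 ≤ Q * Real.sqrt Md := by positivity
    have h2 : 0 ≤ Md / Real.sqrt U := by positivity
    have h3 : 0 ≤ Md / Q₁ := by positivity
    have hf : 1 ≤ (2 * d + 1) * Real.log M := by nlinarith
    have hNI : 2 * Real.log Q + 1 ≤ (2 * d + 1) * Real.log M := by nlinarith
    calc Q * Real.sqrt Md + (2 * Real.log Q + 1) * (Md / Real.sqrt U) + Md / Q₁
        ≤ (2 * d + 1) * Real.log M * (Q * Real.sqrt Md) + (2 * d + 1) * Real.log M * (Md / Real.sqrt U) +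
            (2 * d + 1) * Real.log M * (Md / Q₁) :=
          add_le_add (add_le_add (le_mul_of_one_le_left h1 hf) (mul_le_mul_of_nonneg_right hNI h2))
            (le_mul_of_one_le_left h3 hf)
      _ = _ := by ring
  -- fold atoms and finish
  obtain ⟨lM, hlM⟩ : ∃ lM : ℝ, lM = Real.log M := ⟨_, rfl⟩
  obtain ⟨br, hbrd⟩ : ∃ br : ℝ, br = Q * Real.sqrt Md + (2 * Real.log Q + 1) * (Md / Real.sqrt U) + Md / Q₁ := ⟨_, rfl⟩
  obtain ⟨br', hbrd'⟩ : ∃ br' : ℝ, br' = Q * Real.sqrt Md + Md / Real.sqrt U + Md / Q₁ := ⟨_, rfl⟩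
  obtain ⟨l2, hl2⟩ : ∃ l2 : ℝ, l2 = Real.log (2 * Md) := ⟨_, rfl⟩
  obtain ⟨P1, hP1⟩ : ∃ P1 : ℝ, P1 = (1 + Real.log M) ^ rk := ⟨_, rfl⟩
  rw [← hP1] at hpowle ⊢
  rw [← hlM] at hJle hlog2Md hpowle hbr hlogM1 hlogM0
  rw [← hbrd, ← hbrd'] at hbr ⊢
  rw [← hl2] at hlog2Md hlog2Md0 ⊢
  rw [← hlM]
  have hbr'0 : 0 ≤ br' := by rw [hbrd']; positivity
  have hbr0 : 0 ≤ br := by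
    rw [hbrd]
    have : 0 ≤ (2 * Real.log Q + 1) * (Md / Real.sqrt U) := mul_nonneg (by linarith) (by positivity)
    positivity
  have hP10 : 0 ≤ P1 := by rw [hP1]; exact pow_nonneg (by linarith) _
  have hJ0 : 0 ≤ (J : ℝ) := Nat.cast_nonneg _
  have hh0 : 0 ≤ (h : ℝ) := Nat.cast_nonneg _
  calc (h : ℝ) * J * (C₁ * Kk * P1 * sH * l2 * br)
      ≤ (h : ℝ) * ((2 * d + 1) * lM) * (C₁ * Kk * (2 ^ rk * lM ^ rk) * sH * ((d + 1) * lM) * ((2 * d + 1) * lM * br')) := by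
        have hin : C₁ * Kk * P1 * sH * l2 * br ≤ C₁ * Kk * (2 ^ rk * lM ^ rk) * sH * ((d + 1) * lM) * ((2 * d + 1) * lM * br') := by
          have hCK : 0 ≤ C₁ * Kk := mul_nonneg hC₁.le hKk0
          calc C₁ * Kk * P1 * sH * l2 * br = (C₁ * Kk) * (P1 * (sH * (l2 * br))) := by ring
            _ ≤ (C₁ * Kk) * ((2 ^ rk * lM ^ rk) * (sH * (((d + 1) * lM) * ((2 * d + 1) * lM * br')))) := by
                refine mul_le_mul_of_nonneg_left ?_ hCK
                refine mul_le_mul hpowle ?_ (by positivity) (by positivity)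
                refine mul_le_mul_of_nonneg_left ?_ hsH0
                exact mul_le_mul hlog2Md hbr hbr0 (by positivity)
            _ = _ := by ring
        have h0 : 0 ≤ C₁ * Kk * P1 * sH * l2 * br := by have := hC₁.le; positivity
        calc (h : ℝ) * J * (C₁ * Kk * P1 * sH * l2 * br) ≤ (h : ℝ) * ((2 * d + 1) * lM) * (C₁ * Kk * P1 * sH * l2 * br) :=
              mul_le_mul_of_nonneg_right (mul_le_mul_of_nonneg_left hJle hh0) h0
          _ ≤ _ := mul_le_mul_of_nonneg_left hin (by positivity)
    _ = (C₁ * h * (2 * d + 1) * 2 ^ rk * (d + 1) * (2 * d + 1)) * Kk * lM ^ (rk + 3) * sH * br' := by ring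
    _ ≤ (C₁ * h * (2 * d + 1) * 2 ^ rk * (d + 1) * (2 * d + 1) + 1) * Kk * lM ^ (rk + 3) * sH * br' := by
        have : 0 ≤ Kk * lM ^ (rk + 3) * sH * br' := by positivity
        calc (C₁ * h * (2 * d + 1) * 2 ^ rk * (d + 1) * (2 * d + 1)) * Kk * lM ^ (rk + 3) * sH * br'
            = (C₁ * h * (2 * d + 1) * 2 ^ rk * (d + 1) * (2 * d + 1)) * (Kk * lM ^ (rk + 3) * sH * br') := by ring
          _ ≤ (C₁ * h * (2 * d + 1) * 2 ^ rk * (d + 1) * (2 * d + 1) + 1) * (Kk * lM ^ (rk + 3) * sH * br') :=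
              mul_le_mul_of_nonneg_right (by linarith) this
          _ = _ := by ring

end Literature.NumberTheory.Sieve.TypeTwoBound
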